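import Mathlib
import Literature.Analysis.FunctionSpaces.DiagonalWeakLimits

/-!
# Helly's selection with local bounds (glue for crux `ContactMeasureLimit`, line `IdeatorOneSketch`)

Crux `ContactStieltjesMeasure.ContactMeasureLimit` (stmt-AtomisticToContinuum-15250), line `IdeatorOneSketch`
(idea `escaped-mass-stieltjes-constant`): the Stieltjes continuity theorem for the contact kernel needs a
compactness step for families of monotone functions that are bounded at each point uniformly in `N` but NOT
uniformly bounded (the one-friction a priori bound `F_N(t) ≤ (γ²+t²)·sup_N ∫F_N k_γ` grows like `t²`).

`helly_local`: from a family of monotone functions vanishing on `(-∞,0]` and pointwise bounded uniformly in `N`,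
extract a subsequence converging, at every continuity point `t > 0` of a monotone limit `G` vanishing on
`(-∞,0]`, to `G t`. Proof: diagonal extraction at the rationals (tree:
`Literature.Analysis.FunctionSpaces.exists_strictMono_forall_tendsto_real`, Leray 1934 / Ożański–Pooley 2018),
`G t := sup {l q : q < t rational}` with `l q` the rational limits, and a squeeze through rationals at the
continuity points of `G` (Carothers 2000, Lemma 13.15 / Helly 1912, in the locally bounded form).
-/

noncomputable section

namespace Summit.AtomisticToContinuum.FouriersLaw.Theorems.ContactMeasureLimit

open Filter Set Topology

/-- **Helly with local bounds.** From a family of monotone functions `F N : ℝ → ℝ` vanishing on `(-∞,0]` and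
bounded at each point uniformly in `N`, one can extract a subsequence `F (φ k)` converging, at every continuity
point `t > 0` of some monotone `G` vanishing on `(-∞,0]`, to `G t`. [cite: Carothers2000, Lemma 13.15] -/
theorem helly_local :
    ∀ F : ℕ → ℝ → ℝ, (∀ N : ℕ, Monotone (F N)) → (∀ (N : ℕ) (s : ℝ), s ≤ 0 → F N s = 0) →
      (∀ t : ℝ, ∃ C : ℝ, ∀ N : ℕ, F N t ≤ C) →
      ∃ φ : ℕ → ℕ, StrictMono φ ∧ ∃ G : ℝ → ℝ, Monotone G ∧ (∀ s : ℝ, s ≤ 0 → G s = 0) ∧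
        ∀ t : ℝ, 0 < t → ContinuousAt G t →
          Filter.Tendsto (fun k : ℕ => F (φ k) t) Filter.atTop (nhds (G t)) := by
  intro F hF hF0 hbd
  have hFnn : ∀ N t, 0 ≤ F N t := by
    intro N t
    rcases le_or_gt t 0 with ht | ht
    · rw [hF0 N t ht]
    · have h := hF N ht.le
      rwa [hF0 N 0 le_rfl] at h
  obtain ⟨φ, hφ, hconv⟩ :=
    Literature.Analysis.FunctionSpaces.exists_strictMono_forall_tendsto_real
      (fun n (q : ℚ) => F n q) (fun q => by
        obtain ⟨C, hC⟩ := hbd q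
        refine ⟨|C|, fun n => ?_⟩
        show |F n q| ≤ |C|
        rw [abs_of_nonneg (hFnn _ _)]
        exact (hC _).trans (le_abs_self C))
  choose l hl using hconv
  have hlmono : ∀ q q' : ℚ, q ≤ q' → l q ≤ l q' := fun q q' hqq' =>
    le_of_tendsto_of_tendsto (hl q) (hl q')
      (Eventually.of_forall fun n => hF _ (by exact_mod_cast hqq'))
  let S : ℝ → Set ℝ := fun t => l '' {q : ℚ | (q : ℝ) < t}
  have hSne : ∀ t, 0 < t → (S t).Nonempty := fun t ht =>
    ⟨l 0, 0, by simpa using ht, rfl⟩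
  have hSbdd : ∀ t, BddAbove (S t) := fun t => by
    obtain ⟨q', hq'⟩ := exists_rat_gt t
    refine ⟨l q', ?_⟩
    rintro _ ⟨q, hq, rfl⟩
    exact hlmono q q' (by exact_mod_cast (lt_trans hq hq').le)
  have hSmono : ∀ t t', t ≤ t' → S t ⊆ S t' := fun t t' htt' => by
    rintro _ ⟨q, hq, rfl⟩
    exact ⟨q, lt_of_lt_of_le hq htt', rfl⟩
  let G : ℝ → ℝ := fun t => if t ≤ 0 then 0 else sSup (S t)
  have hGpos : ∀ t, 0 < t → G t = sSup (S t) := fun t ht => if_neg (not_le.2 ht)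
  have hGnp : ∀ t, t ≤ 0 → G t = 0 := fun t ht => if_pos ht
  have hl0 : 0 ≤ l 0 := ge_of_tendsto (hl 0) (Eventually.of_forall fun n => hFnn _ _)
  have hGnn : ∀ t, 0 ≤ G t := fun t => by
    rcases le_or_gt t 0 with ht | ht
    · rw [hGnp t ht]
    · rw [hGpos t ht]
      exact hl0.trans (le_csSup (hSbdd t) ⟨0, by simpa using ht, rfl⟩)
  have hGmono : Monotone G := by
    intro t t' htt'
    rcases le_or_gt t 0 with ht | ht
    · rw [hGnp t ht]; exact hGnn t'
    · rw [hGpos t ht, hGpos t' (ht.trans_le htt')]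
      exact csSup_le_csSup (hSbdd t') (hSne t ht) (hSmono t t' htt')
  refine ⟨φ, hφ, G, hGmono, hGnp, fun t ht hcont => ?_⟩
  rw [hGpos t ht]
  refine tendsto_order.2 ⟨fun x hx => ?_, fun x hx => ?_⟩
  · obtain ⟨_, ⟨q, hq, rfl⟩, hxq⟩ := exists_lt_of_lt_csSup (hSne t ht) hx
    filter_upwards [(hl q).eventually (lt_mem_nhds hxq)] with n hn
    exact hn.trans_le (hF _ hq.le)
  · have hx' : G t < x := by rwa [hGpos t ht]
    have hev : ∀ᶠ y in 𝓝 t, G y < x := hcont.eventually (gt_mem_nhds hx')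
    obtain ⟨lo, hi, ⟨hlo, hhi⟩, hsub⟩ := mem_nhds_iff_exists_Ioo_subset.1 hev
    obtain ⟨q', htq', hq'hi⟩ := exists_rat_btwn hhi
    have hmid : ((q' : ℝ) + hi) / 2 ∈ Ioo lo hi := ⟨by linarith, by linarith⟩
    have hGmid : G (((q' : ℝ) + hi) / 2) < x := hsub hmid
    have hmidpos : 0 < ((q' : ℝ) + hi) / 2 := by linarith
    rw [hGpos _ hmidpos] at hGmid
    have hlq' : l q' ≤ sSup (S (((q' : ℝ) + hi) / 2)) :=
      le_csSup (hSbdd _) ⟨q', by show (q' : ℝ) < ((q' : ℝ) + hi) / 2; linarith, rfl⟩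
    have hlx : l q' < x := hlq'.trans_lt hGmid
    filter_upwards [(hl q').eventually (gt_mem_nhds hlx)] with n hn
    exact (hF _ htq'.le).trans_lt hn

end Summit.AtomisticToContinuum.FouriersLaw.Theorems.ContactMeasureLimit

end
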